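import Mathlib
import Summits.ValiantsHypothesis.ValiantsHypothesis.Theorems.DivisionGapPerMultiplesHardStubFaceDescent
import Literature.Computability.AlgebraicComplexity.ArithCircuitProofs
import Literature.Computability.AlgebraicComplexity.PermanentIrreducible

/-!
# `DivisionGap.PerMultiplesHard` (stmt-ValiantsHypothesis-5068), line `uncharged-face-walk`:
the many-parts face move (stub `stub_hostDescent`)

Let `w` be a weight on the cells of the `n × n` grid and `G ⊆ [n]²` the face it CUTS OUT: a
permutation lies inside `G` iff its `w`-weight `Σ_i w (σ i, i)` is maximal.  For a multiplier
`h ≠ 0` over `ℝ≥0` let `q := proj_G (top_w h)` be the top `w`-component of `h` with every variable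
OFF `G` sent to `1` (`proj_G = aeval (fun e => if e ∈ G then X e else 1)`).  Then

* `supp q = { m|_G : m ∈ supp (top_w h) }`, `m|_G = m.filter (· ∈ G)` — over `ℝ≥0` coefficients
  add without cancellation;
* `L⁺(per_G · q) ≤ L⁺(per_n · h)`, `per_G = Σ_{σ ⊆ G} x^{μ_σ}` the face permanent,

for the tree's monotone fan-in-two `complexity` over `ℝ≥0`.

Mechanism (steps (1)–(2) of `FaceDescent.stub_faceDescent`, without the single-part hypothesis
and without the rescaling gate).
1. Top components are free (`complexity_topComponent_le`) and multiplicative (`topComponent_mul`)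
   over `ℝ≥0`, and `top_w per_n = per_G` (`FaceDescent.topComponent_perPoly_eq`):
   `L⁺(per_G · top_w h) ≤ L⁺(per_n · h)`.
2. `proj_G` is a Valiant projection (variables to variables or constants), hence free
   (`IsProjection.complexity_le_holds`); it is a ring map fixing `per_G`, so it sends
   `per_G · top_w h` to `per_G · q`.
3. `proj_G (c · x^m) = c · x^{m|_G}` (`FaceDescent.aeval_proj_monomial`), so
   `coeff_d q = Σ_{m ∈ supp top_w h, m|_G = d} coeff_m (top_w h)`, a sum of nonzero elements of
   `ℝ≥0`, which vanishes iff it is empty (`Finset.sum_eq_zero_iff`).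

Log (stub-worker): written on the `FaceDescent` / `TopComponentFree` API. [folklore]
-/

noncomputable section

open MvPolynomial Literature.Computability.AlgebraicComplexity
open scoped NNReal BigOperators
open Summit.ValiantsHypothesis.ValiantsHypothesis.Theorems.ZeroOneTransfer.Negative

namespace Summit.ValiantsHypothesis.ValiantsHypothesis.Theorems.DivisionGap.PerMultiplesHard.HostDescent

variable {n : ℕ}

/-! ### The projection off `G`: support -/

/-- The projection `x_e ↦ x_e` (`e ∈ G`), `x_e ↦ 1` (`e ∉ G`) maps `c · x^m` to `c · x^{m|_G}`.
[folklore] -/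
theorem aeval_proj_monomial_filter (G : Finset (Fin n × Fin n)) (m : (Fin n × Fin n) →₀ ℕ)
    (c : ℝ≥0) :
    aeval (fun e => if e ∈ G then (X e : MvPolynomial (Fin n × Fin n) ℝ≥0) else 1)
        (monomial m c) = monomial (m.filter (fun e => e ∈ G)) c :=
  FaceDescent.aeval_proj_monomial G
    (fun e he => by
      rw [Finsupp.support_filter] at he
      exact (Finset.mem_filter.1 he).2)
    (fun e he => (Finsupp.filter_apply_pos (fun e => e ∈ G) m he).symm) c

/-- The projection of `p`, monomial by monomial. [folklore] -/
theorem aeval_proj_eq_sum (G : Finset (Fin n × Fin n)) (p : MvPolynomial (Fin n × Fin n) ℝ≥0) :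
    aeval (fun e => if e ∈ G then (X e : MvPolynomial (Fin n × Fin n) ℝ≥0) else 1) p =
      ∑ m ∈ p.support, monomial (m.filter (fun e => e ∈ G)) (coeff m p) := by
  conv_lhs => rw [p.as_sum]
  rw [map_sum]
  exact Finset.sum_congr rfl fun m _ => aeval_proj_monomial_filter G m _

/-- Over `ℝ≥0` there is no cancellation: `x^d` occurs in the projection of `p` iff `d = m|_G` for
some exponent `m` of `p`. [folklore] -/
theorem mem_support_aeval_proj_iff (G : Finset (Fin n × Fin n))
    (p : MvPolynomial (Fin n × Fin n) ℝ≥0) (d : (Fin n × Fin n) →₀ ℕ) :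
    d ∈ (aeval (fun e => if e ∈ G then (X e : MvPolynomial (Fin n × Fin n) ℝ≥0) else 1) p).support
      ↔ ∃ m ∈ p.support, m.filter (fun e => e ∈ G) = d := by
  classical
  rw [mem_support_iff, aeval_proj_eq_sum, coeff_sum, Ne, Finset.sum_eq_zero_iff]
  push Not
  refine exists_congr fun m => and_congr_right fun hm => ?_
  rw [coeff_monomial]
  constructor
  · intro h
    by_contra hne
    exact h (if_neg hne)
  · intro h
    rw [if_pos h]
    exact mem_support_iff.1 hm

/-- **Support of the projection.**  `supp (proj_G p) = { m|_G : m ∈ supp p }`. [folklore] -/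
theorem support_aeval_proj (G : Finset (Fin n × Fin n)) (p : MvPolynomial (Fin n × Fin n) ℝ≥0) :
    (aeval (fun e => if e ∈ G then (X e : MvPolynomial (Fin n × Fin n) ℝ≥0) else 1) p).support =
      p.support.image (fun m => m.filter (fun e => e ∈ G)) := by
  ext d
  rw [mem_support_aeval_proj_iff, Finset.mem_image]

/-! ### The projection off `G`: cost -/

/-- The projection fixes the face permanent `per_G`. [folklore] -/
theorem aeval_proj_facePer (G : Finset (Fin n × Fin n)) :
    aeval (fun e => if e ∈ G then (X e : MvPolynomial (Fin n × Fin n) ℝ≥0) else 1)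
        (∑ σ ∈ (Finset.univ : Finset (Equiv.Perm (Fin n))).filter (fun σ => ∀ i, (σ i, i) ∈ G),
          monomial (permMonomial σ) (1 : ℝ≥0)) =
      ∑ σ ∈ (Finset.univ : Finset (Equiv.Perm (Fin n))).filter (fun σ => ∀ i, (σ i, i) ∈ G),
        monomial (permMonomial σ) (1 : ℝ≥0) := by
  rw [map_sum]
  refine Finset.sum_congr rfl fun σ hσ => ?_
  exact FaceDescent.aeval_proj_monomial G
    (FaceDescent.support_permMonomial_subset (Finset.mem_filter.1 hσ).2) (fun e _ => rfl) 1

/-- The projection is a Valiant projection of any product `per_G · p` onto `per_G · proj_G p`,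
hence free: `L⁺(per_G · proj_G p) ≤ L⁺(per_G · p)`. [folklore] -/
theorem complexity_facePer_mul_aeval_proj_le (G : Finset (Fin n × Fin n))
    (p : MvPolynomial (Fin n × Fin n) ℝ≥0) :
    complexity ((∑ σ ∈ (Finset.univ : Finset (Equiv.Perm (Fin n))).filter
          (fun σ => ∀ i, (σ i, i) ∈ G), monomial (permMonomial σ) (1 : ℝ≥0)) *
        aeval (fun e => if e ∈ G then (X e : MvPolynomial (Fin n × Fin n) ℝ≥0) else 1) p) ≤
      complexity ((∑ σ ∈ (Finset.univ : Finset (Equiv.Perm (Fin n))).filter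
          (fun σ => ∀ i, (σ i, i) ∈ G), monomial (permMonomial σ) (1 : ℝ≥0)) * p) := by
  refine IsProjection.complexity_le_holds ⟨fun e => if e ∈ G then X e else 1, fun e => ?_, ?_⟩
  · by_cases he : e ∈ G
    · exact Or.inl ⟨e, if_pos he⟩
    · refine Or.inr ⟨1, ?_⟩
      show (if e ∈ G then X e else 1) = C 1
      rw [if_neg he, C_1]
  · rw [map_mul, aeval_proj_facePer]

/-! ### The stub -/

/-- **Host descent (stub `stub_hostDescent` of line `uncharged-face-walk`): the many-parts face
move.**  If `w` cuts out the face `G` and `h ≠ 0`, let `q := proj_G (top_w h)` be the top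
`w`-component of `h` with the variables off `G` sent to `1`.  Then `supp q` is the set of
`G`-restrictions `m|_G` of the exponents `m` of `top_w h` (no cancellation over `ℝ≥0`), and
`L⁺(per_G · q) ≤ L⁺(per_n · h)`: top components are free and multiplicative over `ℝ≥0`,
`top_w per_n = per_G`, and the projection is free and fixes `per_G`. [folklore] -/
theorem stub_hostDescent :
    ∀ (n : ℕ) (G : Finset (Fin n × Fin n)) (w : Fin n × Fin n → ℕ) (h : MvPolynomial (Fin n × Fin n) ℝ≥0),
      (∀ σ : Equiv.Perm (Fin n),
        (∀ i, (σ i, i) ∈ G) ↔ ∀ τ : Equiv.Perm (Fin n), (∑ i, w (τ i, i)) ≤ ∑ i, w (σ i, i)) →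
      h ≠ 0 →
      (aeval (fun e => if e ∈ G then (X e : MvPolynomial (Fin n × Fin n) ℝ≥0) else 1)
          (topComponent w h)).support =
        (topComponent w h).support.image (fun m => m.filter (fun e => e ∈ G)) ∧
      complexity ((∑ σ ∈ (Finset.univ : Finset (Equiv.Perm (Fin n))).filter (fun σ => ∀ i, (σ i, i) ∈ G),
            monomial (permMonomial σ) (1 : ℝ≥0)) *
          aeval (fun e => if e ∈ G then (X e : MvPolynomial (Fin n × Fin n) ℝ≥0) else 1) (topComponent w h)) ≤
        complexity (perPoly (Fin n) ℝ≥0 * h) := by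
  intro n G w h hcut _
  refine ⟨support_aeval_proj G (topComponent w h), ?_⟩
  refine (complexity_facePer_mul_aeval_proj_le G (topComponent w h)).trans ?_
  -- top components are free and multiplicative; `top_w per_n = per_G`
  rw [← FaceDescent.topComponent_perPoly_eq G w hcut, ← topComponent_mul]
  exact complexity_topComponent_le w _

end Summit.ValiantsHypothesis.ValiantsHypothesis.Theorems.DivisionGap.PerMultiplesHard.HostDescent

end
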